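import Literature.Barriers.AtomisticToContinuum.AnticontinuumLocalizationWellPosed
import HarnessLib

/-!
# The configurational Gibbs measure of the rotor chain and (7.1) for momentum-independent observables

Support file for `Literature/Barriers/AtomisticToContinuum/AnticontinuumLocalization.lean`
(De Roeck–Huveneers 2015, the anti-continuum localization barrier). The Gibbs state
`⟨·⟩_T = Z⁻¹ e^{-H/T} dq dω` of the rotor chain factorises: the momenta `ω_x` are i.i.d. centred
Gaussians of variance `T`, independent of the angles, and the angles are distributed according to
the CONFIGURATIONAL Gibbs measure

  `ν_{N,β,γ}(dq) = Z_q⁻¹ exp(-β ∑_x V_x(q)) dq` on `[0, 2π)^N`, `β = ε/T`,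
  `V_x(q) = γ(1 - cos q_x) + (1 - cos(q_x - q_{x+1}))` (free boundary),

a nearest-neighbour Gibbs measure on the one-dimensional torus chain at inverse temperature `β`
(`RotorChain.configGibbs`). This file DEFINES that measure and VENDORS, as a named fact, the
special case of the decorrelation inequality (7.1) of De Roeck–Huveneers for observables that do
not depend on the momenta (`DeRoeckHuveneers2015_decorrelation_config`); for such `f = u ∘ π_q`,
`g = v ∘ π_q` one has `⟨fg⟩_T = ∫ uv dν_{ε/T}` and `⟨|∇f|²⟩_T = ∑_x ∫ (∂_{q_x}u)² dν_{ε/T}` (the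
`ω`-derivatives vanish), so the fact below is literally (7.1) restricted to this sub-class, in the
same implied form (windows around sites `a`, `b`) as `DeRoeckHuveneers2015_decorrelation` of
`AnticontinuumLocalizationThm2.lean`.

Purpose (plan of the discharge of `DeRoeckHuveneers2015_decorrelation`, recorded in the unit's
notes): (7.1) in general follows from this configurational case and a Gaussian Poincaré
inequality in the momenta (product structure of `⟨·⟩_T`); the configurational case is a statement
about a one-dimensional, finite-range, high-temperature (`β` small) Gibbs measure with compact
spins, provable by the transfer-operator/martingale method. Both steps are carried out in sibling
files; nothing here is used by them except the definitions.

## Contents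

* `HeatConduction.partialConfig` — coordinate partial derivative of a function of the angles
  (`partialQ` of the tree is `partialConfig` of the `ω`-section, `partialQ_eq_partialConfig`).
* `RotorChain.configWeight`, `configPartition`, `configGibbs` — `e^{-β∑V_x}`, `Z_q`,
  `ν_{N,β,γ}` on the angle box `angleBox N = [0, 2π)^N` of `AnticontinuumLocalizationWellPosed.lean`
  (same construction as `gibbsWeight/partitionFunction/gibbsMeasure` of the main file, on
  `Fin N → ℝ`).
* `RotorChain.IsConfigPeriodic`, `DependsOnlyNearConfig`, `configGradSqNorm` — periodicity,
  locality windows and the Dirichlet form `∑_x ∫ (∂_x u)² dμ` for functions of the angles.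
* `DeRoeckHuveneers2015_decorrelation_config` — NAMED FACT, (7.1) for momentum-independent
  observables.
* small API: `gibbsWeight_eq_mul_configWeight` (factorisation of the Boltzmann weight),
  positivity/boundedness/continuity of the weights.
-/

noncomputable section

open MeasureTheory Filter Set
open scoped ContDiff ENNReal

namespace Literature.Barriers.AtomisticToContinuum.HeatConduction

open Literature.MathematicalPhysics.KineticTheory.HeatConduction

/-- Partial derivative of a function of the configuration `q : Fin N → ℝ` along the coordinate
`q_i`: `∂_i u (q) = d/dt u(q[i ↦ t]) |_{t = q_i}`. [folklore] -/
def partialConfig {N : ℕ} (i : Fin N) (u : (Fin N → ℝ) → ℝ) (q : Fin N → ℝ) : ℝ :=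
  deriv (fun t => u (Function.update q i t)) (q i)

/-- `∂_{q_i} f (q, ω)` is the `i`-th configurational partial derivative of the section
`f(·, ω)`. [folklore] -/
theorem partialQ_eq_partialConfig {N : ℕ} (i : Fin N) (f : PhaseSpace N → ℝ) (z : PhaseSpace N) :
    partialQ i f z = partialConfig i (fun q => f (q, z.2)) z.1 := rfl

namespace RotorChain

/-- The configurational Boltzmann weight `e^{-β ∑_x V_x(q)}` of the rotor chain at inverse
temperature `β` (`= ε/T`). [cite: DeRoeckHuveneers2015, §2.1 eq. (2.1) and §2.2] -/
def configWeight (N : ℕ) (β γ : ℝ) (q : Fin N → ℝ) : ℝ :=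
  Real.exp (-β * ∑ x : Fin N, sitePotential N γ q x)

/-- The configurational partition function `Z_q = ∫_{[0,2π)^N} e^{-β∑V_x} dq`. [cite: DeRoeckHuveneers2015, §2.2] -/
def configPartition (N : ℕ) (β γ : ℝ) : ℝ :=
  ∫ q in angleBox N, configWeight N β γ q

/-- The configurational Gibbs measure `ν_{N,β,γ} = Z_q⁻¹ e^{-β∑_x V_x(q)} dq` on `[0, 2π)^N` — the
law of the angles under the Gibbs state `⟨·⟩_T` of the rotor chain (`β = ε/T`), a nearest-neighbour
Gibbs measure of the one-dimensional chain of planar rotors with free boundary conditions. [cite: DeRoeckHuveneers2015, §2.2] -/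
def configGibbs (N : ℕ) (β γ : ℝ) : Measure (Fin N → ℝ) :=
  (ENNReal.ofReal (configPartition N β γ))⁻¹ •
    (volume.restrict (angleBox N)).withDensity fun q => ENNReal.ofReal (configWeight N β γ q)

/-- `u` is a function on the torus `𝕋^N`: `2π`-periodic in every angle. [cite: DeRoeckHuveneers2015, §2.1] -/
def IsConfigPeriodic (N : ℕ) (u : (Fin N → ℝ) → ℝ) : Prop :=
  ∀ (q : Fin N → ℝ) (x : Fin N), u (Function.update q x (q x + 2 * Real.pi)) = u q

/-- `u` depends only on the angles at sites `x` with `|x - a| ≤ R` (configurational version of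
`DependsOnlyNear`). [cite: DeRoeckHuveneers2015, §2.3 Thm 1 and §7] -/
def DependsOnlyNearConfig (N : ℕ) (a : Fin N) (R : ℝ) (u : (Fin N → ℝ) → ℝ) : Prop :=
  ∀ q q' : Fin N → ℝ, (∀ x : Fin N, |(x.val : ℝ) - a.val| ≤ R → q x = q' x) → u q = u q'

/-- The configurational Dirichlet form `∑_x ∫ (∂_{q_x} u)² dμ` (the part `∑_x ⟨|∂_{q_x}f|²⟩_T` of
`⟨|∇f|²⟩_T` in (7.1)). [cite: DeRoeckHuveneers2015, §7 eq. (7.1)] -/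
def configGradSqNorm {N : ℕ} (μ : Measure (Fin N → ℝ)) (u : (Fin N → ℝ) → ℝ) : ℝ :=
  ∑ x : Fin N, ∫ q, partialConfig x u q ^ 2 ∂μ

/-! ### API -/

/-- Unfolding `configGradSqNorm`. [folklore] -/
theorem configGradSqNorm_def {N : ℕ} (μ : Measure (Fin N → ℝ)) (u : (Fin N → ℝ) → ℝ) :
    configGradSqNorm μ u = ∑ x : Fin N, ∫ q, partialConfig x u q ^ 2 ∂μ := rfl

/-- The configurational weight is positive. [folklore] -/
theorem configWeight_pos (N : ℕ) (β γ : ℝ) (q : Fin N → ℝ) : 0 < configWeight N β γ q :=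
  Real.exp_pos _

/-- For `β, γ ≥ 0` the configurational weight is at most `1` (`V_x ≥ 0`). [folklore] -/
theorem configWeight_le_one {N : ℕ} {β γ : ℝ} (hβ : 0 ≤ β) (hγ : 0 ≤ γ) (q : Fin N → ℝ) :
    configWeight N β γ q ≤ 1 := by
  unfold configWeight
  rw [Real.exp_le_one_iff, neg_mul, neg_nonpos]
  exact mul_nonneg hβ (Finset.sum_nonneg fun x _ => sitePotential_nonneg hγ q x)

/-- For `β, γ ≥ 0` the configurational weight is at least `e^{-β(2γ+2)N}` (`V_x ≤ 2γ + 2`). [folklore] -/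
theorem exp_neg_le_configWeight {N : ℕ} {β γ : ℝ} (hβ : 0 ≤ β) (hγ : 0 ≤ γ) (q : Fin N → ℝ) :
    Real.exp (-(β * ((2 * γ + 2) * N))) ≤ configWeight N β γ q := by
  unfold configWeight
  rw [Real.exp_le_exp, neg_mul, neg_le_neg_iff]
  refine mul_le_mul_of_nonneg_left ?_ hβ
  have hV : ∀ x : Fin N, sitePotential N γ q x ≤ 2 * γ + 2 := by
    intro x
    unfold sitePotential
    have h1 : γ * (1 - Real.cos (q x)) ≤ 2 * γ := by
      nlinarith [Real.neg_one_le_cos (q x)]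
    have h2 : ∑ y : Fin N, (if y.val = x.val + 1 then (1 - Real.cos (q x - q y)) else 0) ≤ 2 := by
      calc ∑ y : Fin N, (if y.val = x.val + 1 then (1 - Real.cos (q x - q y)) else 0)
          ≤ ∑ y : Fin N, (if y.val = x.val + 1 then (2 : ℝ) else 0) := by
            refine Finset.sum_le_sum fun y _ => ?_
            split_ifs
            · linarith [Real.neg_one_le_cos (q x - q y)]
            · exact le_rfl
        _ ≤ 2 := by
            rw [Finset.sum_ite, Finset.sum_const_zero, add_zero, Finset.sum_const, nsmul_eq_mul]
            have hc : ((Finset.univ.filter fun y : Fin N => y.val = x.val + 1).card : ℝ) ≤ 1 := by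
              exact_mod_cast Finset.card_le_one.2 fun y hy y' hy' => Fin.ext (by
                simp only [Finset.mem_filter] at hy hy'; omega)
            nlinarith
    linarith
  calc ∑ x : Fin N, sitePotential N γ q x ≤ ∑ _x : Fin N, (2 * γ + 2) := Finset.sum_le_sum fun x _ => hV x
    _ = (2 * γ + 2) * N := by rw [Finset.sum_const, Finset.card_univ, Fintype.card_fin]; ring

/-- The site potentials are continuous functions of the configuration. [folklore] -/
theorem continuous_sitePotential (N : ℕ) (γ : ℝ) (x : Fin N) :
    Continuous fun q : Fin N → ℝ => sitePotential N γ q x := by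
  unfold sitePotential
  refine (continuous_const.mul (continuous_const.sub
    (Real.continuous_cos.comp (continuous_apply x)))).add (continuous_finsetSum _ fun y _ => ?_)
  split_ifs
  · exact continuous_const.sub
      (Real.continuous_cos.comp ((continuous_apply x).sub (continuous_apply y)))
  · exact continuous_const

/-- The configurational weight is continuous. [folklore] -/
theorem continuous_configWeight (N : ℕ) (β γ : ℝ) : Continuous (configWeight N β γ) := by
  unfold configWeight
  exact Real.continuous_exp.comp (continuous_const.mul
    (continuous_finsetSum _ fun x _ => continuous_sitePotential N γ x))

/-- Factorisation of the Boltzmann weight: `e^{-H(q,ω)/T} = e^{-∑ω_x²/(2T)} · e^{-(ε/T)∑V_x(q)}`. [cite: DeRoeckHuveneers2015, §2.1 eq. (2.1)] -/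
theorem gibbsWeight_eq_mul_configWeight (N : ℕ) (T ε γ : ℝ) (z : PhaseSpace N) :
    gibbsWeight N T ε γ z =
      Real.exp (-(∑ x : Fin N, z.2 x ^ 2 / 2) / T) * configWeight N (ε / T) γ z.1 := by
  unfold gibbsWeight configWeight hamiltonian siteEnergy
  rw [← Real.exp_add]
  congr 1
  rw [Finset.sum_add_distrib, ← Finset.mul_sum]
  ring

end RotorChain

end Literature.Barriers.AtomisticToContinuum.HeatConduction

namespace Literature.Barriers.AtomisticToContinuum

open Literature.MathematicalPhysics.KineticTheory.HeatConduction HeatConduction HeatConduction.RotorChain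

/-- **De Roeck–Huveneers 2015, eq. (7.1), for momentum-independent observables.** The
decorrelation inequality "`|⟨fg⟩_T| ≤ C e^{-c d(S(f),S(g))} ⟨|∇f|²⟩_T^{1/2} ⟨|∇g|²⟩_T^{1/2}` for
smooth `f, g` on `Ω` with `⟨f⟩_T = ⟨g⟩_T = 0`", asserted in the source for all sufficiently small
`ε` at given `T` ("General results in [Ledoux] apply to the measures corresponding to the
Hamiltonians (2.1) and (2.3), if `ε` is small enough for a given temperature `T` … the only genuine
requirement is a Poincaré inequality for the one-site measure"), in the special case of observables
`f = u ∘ π_q`, `g = v ∘ π_q` depending on the angles only: then `⟨fg⟩_T = ∫ uv dν_β`,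
`⟨|∇f|²⟩_T = ∑_x ∫ (∂_{q_x} u)² dν_β` with `ν_β = configGibbs N β γ`, `β = ε/T` (only the ratio
enters), and (7.1) reads: for `γ ≥ 0` there are `C, c, β₁ > 0` such that for all `0 < β < β₁`,
all `N ≥ 1`, all smooth `2π`-periodic `u, v` on `ℝ^N` with `u` depending only on the angles at
sites within distance `R_u` of `a`, `v` on those within `R_v` of `b`
(so `d(S(u), S(v)) ≥ |a - b| - R_u - R_v`) and `∫ u dν_β = ∫ v dν_β = 0`:
`|∫ uv dν_β| ≤ C e^{-c(|a - b| - R_u - R_v)} (∑_x∫(∂_x u)²dν_β)^{1/2} (∑_x∫(∂_x v)²dν_β)^{1/2}`.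
(A statement about a one-dimensional nearest-neighbour Gibbs measure with compact spins at high
temperature; all integrals are over the bounded box `[0, 2π)^N`, where `u, v` and their partial
derivatives are bounded.) [cite: DeRoeckHuveneers2015, §7 eq. (7.1)] -/
def DeRoeckHuveneers2015_decorrelation_config : Prop :=
  ∀ γ : ℝ, 0 ≤ γ →
    ∃ C c β₁ : ℝ, 0 < c ∧ 0 < β₁ ∧ ∀ β : ℝ, 0 < β → β < β₁ → ∀ N : ℕ, 0 < N →
      ∀ (u v : (Fin N → ℝ) → ℝ) (a b : Fin N) (Ru Rv : ℝ),
        ContDiff ℝ ∞ u → ContDiff ℝ ∞ v → IsConfigPeriodic N u → IsConfigPeriodic N v →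
        DependsOnlyNearConfig N a Ru u → DependsOnlyNearConfig N b Rv v →
        ∫ q, u q ∂(configGibbs N β γ) = 0 → ∫ q, v q ∂(configGibbs N β γ) = 0 →
        |∫ q, u q * v q ∂(configGibbs N β γ)| ≤
          C * Real.exp (-c * (|(a.val : ℝ) - b.val| - Ru - Rv)) *
            Real.sqrt (configGradSqNorm (configGibbs N β γ) u) *
            Real.sqrt (configGradSqNorm (configGibbs N β γ) v)

end Literature.Barriers.AtomisticToContinuum

end
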